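import Mathlib.Algebra.MvPolynomial.Equiv
import Mathlib.RingTheory.MvPolynomial.Homogeneous
import Mathlib.RingTheory.MvPolynomial.Tower
import Literature.Computability.AlgebraicComplexity.GKSS19HardnessToHittingSets
import Literature.Computability.AlgebraicComplexity.FSS14TransferMatrixCode
import HarnessLib

/-!
# Guo–Kumar–Saptharishi–Solomon 2019, §2.4: the calculus of the operators `Δ_i` in the ring
# `F[z][y]` (Observations 21–22, the bidegree bookkeeping, the Euler recursion)

Cell `val-lit`, seat t19 (literature-prover); groundwork for the discharge programme of
`GKSS2019_mainThm` (v2, erratum A34) along the printed proof of [GKSS19, §3]. THEOREM-ONLY apart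
from two plumbing definitions (`GKSS2019.toZY`, `GKSS2019.shiftR`); no named facts; nothing here
bears on `VP ≠ VNP`, which is NOT proved.

Source: Z. Guo, M. Kumar, R. Saptharishi, N. Solomon, *Derandomization from algebraic hardness*,
SIAM J. Comput. 51 (2022) = arXiv:1905.00091 [GuoKumarSaptharishiSolomon2019], §2.4 "The Generator"
(held text `paper:arxiv-1905.00091`, p0010.txt:L38–L60) and the first lines of §3 / §3.1
(p0011.txt, p0012.txt).

## What is here

The typed generator (`GKSS19HardnessToHittingSets.lean`, seat x6) lives in `F[z ⊔ y]`
(`MvPolynomial (Fin k ⊕ Fin k) F`, `inl = z`, `inr = y`): `GKSS2019.shifted P = P(z + y)`,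
`GKSS2019.delta P i = Δ_i(P)` = the `y`-weight-`i` component. The printed proof manipulates
`Δ_i(P)(z, a)` for field points `a` as polynomials in `z`, their homogeneous parts in `z`, and
"`Δ_i(P)` as a generic linear combination of order-`i` data". We transport everything once and for
all to the iterated polynomial ring `R[y]`, `R = F[z]`
(`MvPolynomial (Fin k) (MvPolynomial (Fin k) F)`), where `y`-homogeneous components, coefficients
`coeff_{y^e} ∈ R` and the evaluation `y := a` are Mathlib primitives:

* `GKSS2019.toZY : F[z ⊔ y] ≃ₐ[F] R[y]` (`z ↦` coefficients, `y ↦` variables) and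
  `GKSS2019.shiftR P = P(z + y) ∈ R[y]`; `toZY (shifted P) = shiftR P`,
  **`toZY (delta P i) = homogeneousComponent i (shiftR P)`** (`toZY_delta`), so that
  `C ∘ G_P = 0` reads `C(Δ_0, …, Δ_n) = 0` in `R[y]` (`toZY_bind₁_gen`).
* the closed form `coeff_{y^e} P(z+y) = ∑_b coeff_b(P) · binom(b, e) z^{b-e}` (`coeff_shiftR`, from
  the tree's `FSS2014.coeff_aeval_X_add_C`), `coeff_{y^0} P(z + y) = P` (`coeff_zero_shiftR`);
* BIDEGREE (the sentence "`Δ_n(P_{i+1})` is a homogeneous (in `z`) polynomial of degree `(i-n+1)`",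
  p0007.txt:L17, and Obs. 22): for `P` homogeneous of degree `ℓ` every `y`-coefficient
  `coeff_{y^e} P(z+y)` is `z`-homogeneous of degree `ℓ - |e|` (`isHomogeneous_coeff_shiftR`), the
  components `Δ_i(P)` vanish for `i > ℓ` (`homogeneousComponent_shiftR_eq_zero`), and
  `Δ_i(P)(z, a)` is `z`-homogeneous of degree `ℓ - i` (`isHomogeneous_evalC_homogeneousComponent_shiftR`);
* Obs. 21 (translation `z ↦ z + b` acts on `P(z + y)` coefficientwise, `shiftR_translate`,
  `homogeneousComponent_map`);
* the EULER RECURSION behind "we can also compute all its lower order derivatives via repeated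
  applications of Euler's formula (Fact 10)" (p0007.txt:L27, p0012.txt:L8): for `P` homogeneous of
  degree `ℓ`, `∑_j (e_j + 1) · z_j · coeff_{y^{e + δ_j}} P(z+y) = (ℓ - |e|) · coeff_{y^e} P(z+y)`
  (`euler_coeff_shiftR`) — in characteristic `0` the coefficients are `∂_{z^e} P / e!` and this is
  Euler's formula for `∂_{z^e} P`; the coefficient form needs no division by `e!`.

## References
* [GuoKumarSaptharishiSolomon2019] arXiv:1905.00091, §2.4 Def. of `Δ_i` / `G_P` (p0010.txt:L38–44),
  Obs. 21 (p0010.txt:L48–51), Obs. 22 (p0010.txt:L53–55), Fact 10 (p0007.txt:L29–31), §3.1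
  (p0012.txt:L30–L74).
* [ForbesSaptharishiShpilka2014] Construction 19 (the shift/transfer formula reused here).
-/

noncomputable section

open MvPolynomial

namespace Literature.Computability.AlgebraicComplexity

namespace GKSS2019

universe u

variable {F : Type u} [CommRing F] {k : ℕ}

/-! ### The transport `F[z ⊔ y] ≃ R[y]`, `R = F[z]` -/

/-- The `F`-algebra isomorphism `F[z ⊔ y] ≃ F[z][y]` sending `z_j` (`inl`) to the coefficient
variable `C (X j)` and `y_j` (`inr`) to the outer variable `X j`. [folklore] -/
def toZY (F : Type u) [CommRing F] (k : ℕ) :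
    MvPolynomial (Fin k ⊕ Fin k) F ≃ₐ[F] MvPolynomial (Fin k) (MvPolynomial (Fin k) F) :=
  (renameEquiv F (Equiv.sumComm (Fin k) (Fin k))).trans (sumAlgEquiv F (Fin k) (Fin k))

/-- `toZY (z_j) = C (X j)`. [cite: GuoKumarSaptharishiSolomon2019, §2.4 Def. 9 (arXiv p0010.txt:L38-44), the ring `F[z, y]` of the generator] -/
@[simp] theorem toZY_X_inl (j : Fin k) :
    toZY F k (X (Sum.inl j)) = C (X j) := by
  simp [toZY, sumAlgEquiv_X_inr]

/-- `toZY (y_j) = X j`. [cite: GuoKumarSaptharishiSolomon2019, §2.4 Def. 9 (arXiv p0010.txt:L38-44), the ring `F[z, y]` of the generator] -/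
@[simp] theorem toZY_X_inr (j : Fin k) :
    toZY F k (X (Sum.inr j)) = X j := by
  simp [toZY, sumAlgEquiv_X_inl]

/-- `toZY (c) = C (C c)`. [cite: GuoKumarSaptharishiSolomon2019, §2.4 Def. 9 (arXiv p0010.txt:L38-44), the ring `F[z, y]` of the generator] -/
@[simp] theorem toZY_C (c : F) :
    toZY F k (C c) = C (C c) := by
  simp [toZY, sumAlgEquiv_C_inl]

/-- `P(z + y)` as a polynomial in `y` with coefficients in `R = F[z]` (the object whose
`y`-homogeneous components are the `Δ_i(P)`, §2.4). [cite: GuoKumarSaptharishiSolomon2019, §2.4 Def. 9 (arXiv p0010.txt:L38-44)] -/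
def shiftR (P : MvPolynomial (Fin k) F) : MvPolynomial (Fin k) (MvPolynomial (Fin k) F) :=
  aeval (fun j : Fin k => (X j + C (X j) : MvPolynomial (Fin k) (MvPolynomial (Fin k) F))) P

/-- Unfolding of `shiftR`. [cite: GuoKumarSaptharishiSolomon2019, §2.4 Def. 9 (arXiv p0010.txt:L38-44), the ring `F[z, y]` of the generator] -/
theorem shiftR_apply (P : MvPolynomial (Fin k) F) :
    shiftR P = aeval (fun j : Fin k =>
      (X j + C (X j) : MvPolynomial (Fin k) (MvPolynomial (Fin k) F))) P := rfl

/-- `shiftR` as an `R`-algebra substitution into `P` read with constant coefficients: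
`P(z + y) = (ι P)(y + z)`. [cite: GuoKumarSaptharishiSolomon2019, §2.4 Def. 9 (arXiv p0010.txt:L38-44), the ring `F[z, y]` of the generator] -/
theorem shiftR_eq_aeval_map (P : MvPolynomial (Fin k) F) :
    shiftR P = aeval (fun j : Fin k =>
      (X j + C (X j) : MvPolynomial (Fin k) (MvPolynomial (Fin k) F)))
        (map (algebraMap F (MvPolynomial (Fin k) F)) P) := by
  rw [aeval_map_algebraMap]; rfl

/-- `toZY (P(z+y)) = shiftR P`. [cite: GuoKumarSaptharishiSolomon2019, §2.4 Def. 9 (arXiv p0010.txt:L38-44)] -/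
theorem toZY_shifted (P : MvPolynomial (Fin k) F) : toZY F k (shifted P) = shiftR P := by
  unfold shifted shiftR
  show (toZY F k).toAlgHom (aeval _ P) = _
  rw [comp_aeval_apply]
  have h : (fun i : Fin k => (toZY F k).toAlgHom (X (Sum.inl i) + X (Sum.inr i))) =
      fun j : Fin k => (X j + C (X j) : MvPolynomial (Fin k) (MvPolynomial (Fin k) F)) := by
    funext j
    simp [add_comm]
  rw [h]

/-- The `y`-weight of a monomial of `F[z ⊔ y]` is the total degree of its `y`-part. [folklore] -/
private theorem weight_yWeight (m : Fin k ⊕ Fin k →₀ ℕ) :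
    Finsupp.weight (yWeight k) m = ∑ v ∈ m.support, m v * yWeight k v := by
  rw [Finsupp.weight_apply, Finsupp.sum]
  rfl

/-- `toZY` sends a monomial to a `y`-homogeneous element of degree its `y`-weight. [folklore] -/
private theorem isHomogeneous_toZY_monomial (m : Fin k ⊕ Fin k →₀ ℕ) (c : F) :
    (toZY F k (monomial m c)).IsHomogeneous (Finsupp.weight (yWeight k) m) := by
  classical
  rw [monomial_eq, map_mul, toZY_C, weight_yWeight, Finsupp.prod, map_prod]
  rw [show (∑ v ∈ m.support, m v * yWeight k v) = 0 + ∑ v ∈ m.support, m v * yWeight k v by simp]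
  refine IsHomogeneous.mul (isHomogeneous_C _ _) ?_
  refine IsHomogeneous.prod _ _ _ fun v _ => ?_
  rw [map_pow]
  rcases v with j | j
  · simpa [yWeight] using (isHomogeneous_C (Fin k) (X j : MvPolynomial (Fin k) F)).pow (m (Sum.inl j))
  · simpa [yWeight] using (isHomogeneous_X (MvPolynomial (Fin k) F) j).pow (m (Sum.inr j))

/-- `toZY` maps `y`-weight-homogeneous polynomials to `y`-homogeneous polynomials of the same
degree. [cite: GuoKumarSaptharishiSolomon2019, §2.4 Def. 9 (arXiv p0010.txt:L38-44), the ring `F[z, y]` of the generator] -/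
theorem isHomogeneous_toZY {W : MvPolynomial (Fin k ⊕ Fin k) F} {w : ℕ}
    (hW : IsWeightedHomogeneous (yWeight k) W w) : (toZY F k W).IsHomogeneous w := by
  classical
  rw [W.as_sum, map_sum]
  refine IsHomogeneous.sum _ _ _ fun m hm => ?_
  have hwt : Finsupp.weight (yWeight k) m = w := hW (mem_support_iff.mp hm)
  rw [← hwt]
  exact isHomogeneous_toZY_monomial m _

/-- `toZY` intertwines the `y`-weight components of `F[z ⊔ y]` with the homogeneous components of
`R[y]`. [cite: GuoKumarSaptharishiSolomon2019, §2.4 Def. 9 (arXiv p0010.txt:L38-44), the ring `F[z, y]` of the generator] -/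
theorem toZY_weightedHomogeneousComponent (W : MvPolynomial (Fin k ⊕ Fin k) F) (i : ℕ) :
    toZY F k (weightedHomogeneousComponent (yWeight k) i W) =
      homogeneousComponent i (toZY F k W) := by
  classical
  have hfin := weightedHomogeneousComponent_finsupp (w := yWeight k) W
  set S := hfin.toFinset with hS
  have hdec : W = ∑ w ∈ S, weightedHomogeneousComponent (yWeight k) w W := by
    have h := sum_weightedHomogeneousComponent (yWeight k) W
    rw [finsum_eq_sum _ hfin] at h
    exact h.symm
  have hmem : ∀ w, toZY F k (weightedHomogeneousComponent (yWeight k) w W) ∈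
      homogeneousSubmodule (Fin k) (MvPolynomial (Fin k) F) w := fun w =>
    (mem_homogeneousSubmodule _ _).mpr
      (isHomogeneous_toZY (weightedHomogeneousComponent_isWeightedHomogeneous w W))
  conv_rhs => rw [hdec, map_sum, map_sum]
  simp_rw [fun w => homogeneousComponent_of_mem (m := i) (hmem w)]
  rw [Finset.sum_ite_eq S i fun w => toZY F k (weightedHomogeneousComponent (yWeight k) w W)]
  split_ifs with hi
  · rfl
  · have : weightedHomogeneousComponent (yWeight k) i W = 0 := by
      rw [hS, Set.Finite.mem_toFinset, Function.mem_support, not_not] at hi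
      exact hi
    rw [this, map_zero]

/-- **`Δ_i(P)` is the `y`-degree-`i` homogeneous component of `P(z + y) ∈ F[z][y]`.**
[cite: GuoKumarSaptharishiSolomon2019, §2.4 Def. 9 (arXiv p0010.txt:L38-44)] -/
theorem toZY_delta (P : MvPolynomial (Fin k) F) (i : ℕ) :
    toZY F k (delta P i) = homogeneousComponent i (shiftR P) := by
  rw [delta, toZY_weightedHomogeneousComponent, toZY_shifted]

/-- `C ∘ G_P` transported: `toZY (C(Δ_0(P), …, Δ_n(P))) = C(Δ_0, …, Δ_n)` with the `Δ_i` read in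
`F[z][y]`. [cite: GuoKumarSaptharishiSolomon2019, §2.4 and §3 (arXiv p0010.txt:L44, p0011.txt:L8)] -/
theorem toZY_bind₁_gen (P : MvPolynomial (Fin k) F) (n : ℕ) (C' : MvPolynomial (Fin (n + 1)) F) :
    toZY F k (bind₁ (gen P n) C') =
      aeval (fun i : Fin (n + 1) => homogeneousComponent (i : ℕ) (shiftR P)) C' := by
  show (toZY F k).toAlgHom (aeval (gen P n) C') = _
  rw [comp_aeval_apply]
  have h : (fun i : Fin (n + 1) => (toZY F k).toAlgHom (gen P n i)) =
      fun i : Fin (n + 1) => homogeneousComponent (i : ℕ) (shiftR P) := by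
    funext i
    exact toZY_delta P i
  rw [h]

/-- `C ∘ G_P = 0` iff the transported identity holds in `F[z][y]`. [cite: GuoKumarSaptharishiSolomon2019, §3 (arXiv p0011.txt:L8)] -/
theorem bind₁_gen_eq_zero_iff (P : MvPolynomial (Fin k) F) (n : ℕ)
    (C' : MvPolynomial (Fin (n + 1)) F) :
    bind₁ (gen P n) C' = 0 ↔
      aeval (fun i : Fin (n + 1) => homogeneousComponent (i : ℕ) (shiftR P)) C' = 0 := by
  rw [← toZY_bind₁_gen, map_eq_zero_iff _ (toZY F k).injective]

/-! ### The closed form of the `y`-coefficients of `P(z + y)` and the bidegree bookkeeping -/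

/-- **Closed form**: `coeff_{y^e} P(z + y) = ∑_{b ∈ supp P} coeff_b(P) · ∏_j binom(b_j, e_j) z_j^{b_j - e_j}`
(the tree's transfer formula `FSS2014.coeff_aeval_X_add_C` read over `R = F[z]`).
[cite: ForbesSaptharishiShpilka2014, Construction 19] -/
theorem coeff_shiftR (P : MvPolynomial (Fin k) F) (e : Fin k →₀ ℕ) :
    coeff e (shiftR P) = ∑ b ∈ P.support, C (coeff b P) *
      FSS2014.shiftWt (fun j : Fin k => (X j : MvPolynomial (Fin k) F)) e b := by
  classical
  rw [shiftR_eq_aeval_map, FSS2014.coeff_aeval_X_add_C, MvPolynomial.algebraMap_eq,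
    support_map_of_injective _ (C_injective (Fin k) F)]
  refine Finset.sum_congr rfl fun b _ => ?_
  rw [coeff_map]

/-- The weight `∏_j binom(b_j,e_j) z_j^{b_j-e_j}` is `z`-homogeneous of degree `∑_j (b_j - e_j)`.
[folklore] -/
private theorem isHomogeneous_shiftWt (e b : Fin k →₀ ℕ) :
    (FSS2014.shiftWt (fun j : Fin k => (X j : MvPolynomial (Fin k) F)) e b).IsHomogeneous
      (∑ j, (b j - e j)) := by
  unfold FSS2014.shiftWt
  refine IsHomogeneous.prod _ _ _ fun j _ => ?_
  have hC : IsHomogeneous (((b j).choose (e j) : ℕ) : MvPolynomial (Fin k) F) 0 := by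
    rw [← map_natCast (C : F →+* MvPolynomial (Fin k) F)]
    exact isHomogeneous_C _ _
  simpa using hC.mul ((isHomogeneous_X F j).pow (b j - e j))

/-- If `e ≰ b` the weight vanishes (a binomial coefficient `binom(b_j, e_j)` with `b_j < e_j`).
[folklore] -/
private theorem shiftWt_eq_zero_of_not_le {e b : Fin k →₀ ℕ} (h : ¬ e ≤ b) :
    FSS2014.shiftWt (fun j : Fin k => (X j : MvPolynomial (Fin k) F)) e b = 0 := by
  rw [Finsupp.le_def] at h
  simp only [not_forall, not_le] at h
  obtain ⟨j, hj⟩ := h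
  unfold FSS2014.shiftWt
  exact Finset.prod_eq_zero (Finset.mem_univ j) (by rw [Nat.choose_eq_zero_of_lt hj]; simp)

/-- For `e ≤ b`: `∑_j (b_j - e_j) = |b| - |e|`. [folklore] -/
private theorem sum_tsub_eq_degree_sub {e b : Fin k →₀ ℕ} (h : e ≤ b) :
    ∑ j, (b j - e j) = b.degree - e.degree := by
  rw [Finsupp.degree_eq_sum, Finsupp.degree_eq_sum]
  exact Finset.sum_tsub_distrib _ fun j _ => h j

/-- **Bidegree.** For `P` homogeneous of degree `ℓ` (in `z`), the `y^e`-coefficient of `P(z + y)` is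
`z`-homogeneous of degree `ℓ - |e|` ("`Δ_n(P_{i+1})` is a homogeneous (in `z`) polynomial of degree
`(i-n+1)`"). [cite: GuoKumarSaptharishiSolomon2019, §1.3 (arXiv p0007.txt:L17) and Obs. 22 (p0010.txt:L53-55)] -/
theorem isHomogeneous_coeff_shiftR {P : MvPolynomial (Fin k) F} {ℓ : ℕ} (hP : P.IsHomogeneous ℓ)
    (e : Fin k →₀ ℕ) : (coeff e (shiftR P)).IsHomogeneous (ℓ - e.degree) := by
  classical
  rw [coeff_shiftR]
  refine IsHomogeneous.sum _ _ _ fun b hb => ?_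
  have hbdeg : b.degree = ℓ := by
    have := hP (mem_support_iff.mp hb)
    rwa [Finsupp.degree_eq_weight_one]
  by_cases hle : e ≤ b
  · rw [show ℓ - e.degree = 0 + (ℓ - e.degree) by simp]
    refine IsHomogeneous.mul (isHomogeneous_C _ _) ?_
    rw [← hbdeg, ← sum_tsub_eq_degree_sub hle]
    exact isHomogeneous_shiftWt e b
  · rw [shiftWt_eq_zero_of_not_le hle, mul_zero]
    exact isHomogeneous_zero _ _ _

/-- The `y^e`-coefficients of `P(z + y)` vanish beyond the degree: `|e| > ℓ ⇒ coeff_{y^e} = 0`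
(for `P` homogeneous of degree `ℓ`). [cite: GuoKumarSaptharishiSolomon2019, Obs. 22 (arXiv p0010.txt:L53-55)] -/
theorem coeff_shiftR_eq_zero_of_lt {P : MvPolynomial (Fin k) F} {ℓ : ℕ} (hP : P.IsHomogeneous ℓ)
    {e : Fin k →₀ ℕ} (he : ℓ < e.degree) : coeff e (shiftR P) = 0 := by
  classical
  rw [coeff_shiftR]
  refine Finset.sum_eq_zero fun b hb => ?_
  have hbdeg : b.degree = ℓ := by
    have := hP (mem_support_iff.mp hb)
    rwa [Finsupp.degree_eq_weight_one]
  have hle : ¬ e ≤ b := fun hle => by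
    have hdm : e.degree ≤ b.degree := Finsupp.degree_mono hle
    omega
  rw [shiftWt_eq_zero_of_not_le hle, mul_zero]

/-- `Δ_i(P) = 0` for `i > deg P` (`P` homogeneous of degree `ℓ < i`).
[cite: GuoKumarSaptharishiSolomon2019, Obs. 22 (arXiv p0010.txt:L53-55)] -/
theorem homogeneousComponent_shiftR_eq_zero {P : MvPolynomial (Fin k) F} {ℓ i : ℕ}
    (hP : P.IsHomogeneous ℓ) (hi : ℓ < i) : homogeneousComponent i (shiftR P) = 0 := by
  classical
  refine MvPolynomial.ext _ _ fun e => ?_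
  rw [coeff_homogeneousComponent, coeff_zero]
  split_ifs with he
  · exact coeff_shiftR_eq_zero_of_lt (e := e) hP (by rw [he]; exact hi)
  · rfl

/-- `coeff_{y^0} P(z + y) = P(z)`. [cite: GuoKumarSaptharishiSolomon2019, §2.4 (arXiv p0010.txt:L38-44), `Δ_0(P)(z,y) = P(z)`] -/
theorem coeff_zero_shiftR (P : MvPolynomial (Fin k) F) : coeff 0 (shiftR P) = P := by
  classical
  rw [coeff_shiftR]
  have h : ∀ b ∈ P.support, C (coeff b P) *
      FSS2014.shiftWt (fun j : Fin k => (X j : MvPolynomial (Fin k) F)) 0 b =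
        monomial b (coeff b P) := by
    intro b _
    rw [FSS2014.shiftWt, monomial_eq, Finsupp.prod_fintype _ _ (fun _ => pow_zero _)]
    simp
  rw [Finset.sum_congr rfl h]
  exact (MvPolynomial.as_sum P).symm

/-- `Δ_0(P) = P` read in `R[y]`: the `y`-degree-`0` component of `P(z+y)` is the constant `C P`.
[cite: GuoKumarSaptharishiSolomon2019, §2.4 (arXiv p0010.txt:L38-44)] -/
theorem homogeneousComponent_zero_shiftR (P : MvPolynomial (Fin k) F) :
    homogeneousComponent 0 (shiftR P) = C P := by
  rw [homogeneousComponent_zero, coeff_zero_shiftR]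

/-! ### Evaluation `y := a` and the `z`-degrees of `Δ_i(P_ℓ)(z, a)` -/

/-- `Δ_i(P)(z, a)` for `P` homogeneous of degree `ℓ` is `z`-homogeneous of degree `ℓ - i`.
[cite: GuoKumarSaptharishiSolomon2019, §1.3 (arXiv p0007.txt:L17) and §3.1 (p0012.txt:L33-36)] -/
theorem isHomogeneous_eval_homogeneousComponent_shiftR {P : MvPolynomial (Fin k) F} {ℓ : ℕ}
    (hP : P.IsHomogeneous ℓ) (g : Fin k → F) (i : ℕ) :
    (eval (fun j => C (g j)) (homogeneousComponent i (shiftR P))).IsHomogeneous (ℓ - i) := by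
  classical
  rw [eval_eq]
  refine IsHomogeneous.sum _ _ _ fun e _ => ?_
  have hcoef : (coeff e (homogeneousComponent i (shiftR P))).IsHomogeneous (ℓ - i) := by
    rw [coeff_homogeneousComponent]
    split_ifs with hed
    · have h := isHomogeneous_coeff_shiftR hP e
      rwa [hed] at h
    · exact isHomogeneous_zero _ _ _
  have hprod : (∏ j ∈ e.support, (C (g j) : MvPolynomial (Fin k) F) ^ e j).IsHomogeneous 0 := by
    have h := IsHomogeneous.prod e.support (fun j => (C (g j) : MvPolynomial (Fin k) F) ^ e j)
      (fun _ => 0) (fun j _ => by simpa using (isHomogeneous_C (Fin k) (g j)).pow (e j))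
    simpa using h
  simpa using hcoef.mul hprod

/-- For `i < ℓ` the constant term of `Δ_i(P_ℓ)(z, a)` vanishes; for `i > ℓ` the whole thing does.
[cite: GuoKumarSaptharishiSolomon2019, §3.1 (arXiv p0012.txt:L50-56)] -/
theorem constantCoeff_eval_homogeneousComponent_shiftR_of_ne {P : MvPolynomial (Fin k) F} {ℓ : ℕ}
    (hP : P.IsHomogeneous ℓ) (g : Fin k → F) {i : ℕ} (hi : i ≠ ℓ) :
    constantCoeff (eval (fun j => C (g j)) (homogeneousComponent i (shiftR P))) = 0 := by
  by_cases hlt : ℓ < i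
  · rw [homogeneousComponent_shiftR_eq_zero hP hlt, map_zero, map_zero]
  · have h := isHomogeneous_eval_homogeneousComponent_shiftR hP g i
    change coeff 0 _ = 0
    exact h.coeff_eq_zero (by rw [map_zero]; omega)

/-! ### Obs. 21: translating `z` acts coefficientwise on `P(z + y)` -/

/-- The homogeneous components of `R[y]` commute with coefficientwise ring maps. [cite: GuoKumarSaptharishiSolomon2019, Obs. 21 (arXiv p0010.txt:L48-51), coefficientwise step] -/
theorem homogeneousComponent_map {R S : Type*} [CommSemiring R] [CommSemiring S] {σ : Type*}
    (f : R →+* S) (i : ℕ) (W : MvPolynomial σ R) :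
    homogeneousComponent i (map f W) = map f (homogeneousComponent i W) := by
  classical
  refine MvPolynomial.ext _ _ fun e => ?_
  rw [coeff_homogeneousComponent, coeff_map, coeff_map, coeff_homogeneousComponent]
  split_ifs <;> simp

/-- **Obs. 21** ("if `P'(z) = P(z + a)` then `Δ_i(P')(z, y) = Δ_i(P)(z + a, y)`"): translating `z`
by `b` acts on `P(z + y) ∈ R[y]` through the coefficient ring `R = F[z]`.
[cite: GuoKumarSaptharishiSolomon2019, Obs. 21 (arXiv p0010.txt:L48-51)] -/
theorem shiftR_translate (b : Fin k → F) (P : MvPolynomial (Fin k) F) :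
    shiftR (aeval (fun j : Fin k => (X j + C (b j) : MvPolynomial (Fin k) F)) P) =
      map ((aeval (fun j : Fin k => (X j + C (b j) : MvPolynomial (Fin k) F))).toRingHom)
        (shiftR P) := by
  have h : ((aeval fun j : Fin k =>
        (X j + C (X j) : MvPolynomial (Fin k) (MvPolynomial (Fin k) F))).comp
      (aeval fun j : Fin k => (X j + C (b j) : MvPolynomial (Fin k) F))) =
      (mapAlgHom (aeval fun j : Fin k => (X j + C (b j) : MvPolynomial (Fin k) F))).comp
        (aeval fun j : Fin k =>
          (X j + C (X j) : MvPolynomial (Fin k) (MvPolynomial (Fin k) F))) := by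
    refine MvPolynomial.algHom_ext fun j => ?_
    simp only [AlgHom.comp_apply, aeval_X, map_add, aeval_C, mapAlgHom_apply, map_X, map_C]
    simp only [RingHom.coe_coe, map_add, aeval_X,
      IsScalarTower.algebraMap_apply F (MvPolynomial (Fin k) F)
        (MvPolynomial (Fin k) (MvPolynomial (Fin k) F)),
      MvPolynomial.algebraMap_eq, add_assoc]
  have := AlgHom.congr_fun h P
  simpa [shiftR] using this

/-- Obs. 21 for the components: `Δ_i(P(· + b)) = τ_b ⋆ Δ_i(P)` coefficientwise.
[cite: GuoKumarSaptharishiSolomon2019, Obs. 21 (arXiv p0010.txt:L48-51)] -/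
theorem homogeneousComponent_shiftR_translate (b : Fin k → F) (P : MvPolynomial (Fin k) F) (i : ℕ) :
    homogeneousComponent i
        (shiftR (aeval (fun j : Fin k => (X j + C (b j) : MvPolynomial (Fin k) F)) P)) =
      map ((aeval (fun j : Fin k => (X j + C (b j) : MvPolynomial (Fin k) F))).toRingHom)
        (homogeneousComponent i (shiftR P)) := by
  rw [shiftR_translate, homogeneousComponent_map]

/-! ### The Euler recursion on the `y`-coefficients (Fact 10 without factorials) -/

/-- One column of the recursion on the transfer weights:
`(e_j+1) · z_j · binom(b, e+δ_j) z^{b-e-δ_j} = (b_j - e_j) · binom(b, e) z^{b-e}`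
(`(e+1)·C(b,e+1) = (b-e)·C(b,e)`). [folklore] -/
private theorem euler_shiftWt_single (e b : Fin k →₀ ℕ) (j : Fin k) :
    ((e j + 1 : ℕ) : MvPolynomial (Fin k) F) * (X j *
      FSS2014.shiftWt (fun j : Fin k => (X j : MvPolynomial (Fin k) F))
        (e + Finsupp.single j 1) b) =
    ((b j - e j : ℕ) : MvPolynomial (Fin k) F) *
      FSS2014.shiftWt (fun j : Fin k => (X j : MvPolynomial (Fin k) F)) e b := by
  classical
  unfold FSS2014.shiftWt
  rw [← Finset.mul_prod_erase Finset.univ _ (Finset.mem_univ j),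
    ← Finset.mul_prod_erase Finset.univ
      (fun i => ((b i).choose (e i) : MvPolynomial (Fin k) F) * X i ^ (b i - e i))
      (Finset.mem_univ j)]
  have hrest : (∏ i ∈ Finset.univ.erase j,
      (((b i).choose ((e + Finsupp.single j 1 : Fin k →₀ ℕ) i) : MvPolynomial (Fin k) F) *
        X i ^ (b i - (e + Finsupp.single j 1 : Fin k →₀ ℕ) i))) =
      ∏ i ∈ Finset.univ.erase j, (((b i).choose (e i) : MvPolynomial (Fin k) F) *
        X i ^ (b i - e i)) := by
    refine Finset.prod_congr rfl fun i hi => ?_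
    have hij : i ≠ j := Finset.ne_of_mem_erase hi
    simp [hij]
  rw [hrest]
  set R := ∏ i ∈ Finset.univ.erase j, (((b i).choose (e i) : MvPolynomial (Fin k) F) *
        X i ^ (b i - e i)) with hR
  have hj : (e + Finsupp.single j 1 : Fin k →₀ ℕ) j = e j + 1 := by simp
  rw [hj]
  by_cases hlt : e j < b j
  · set t := b j - (e j + 1) with ht
    have ht1 : b j - e j = t + 1 := by omega
    have hnat : (e j + 1) * (b j).choose (e j + 1) = (b j - e j) * (b j).choose (e j) := by
      rw [mul_comm, Nat.choose_succ_right_eq, mul_comm]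
    rw [ht1] at hnat ⊢
    calc ((e j + 1 : ℕ) : MvPolynomial (Fin k) F) *
          (X j * ((((b j).choose (e j + 1) : ℕ) : MvPolynomial (Fin k) F) * X j ^ t * R))
        = (((e j + 1) * (b j).choose (e j + 1) : ℕ) : MvPolynomial (Fin k) F) *
            (X j ^ (t + 1) * R) := by push_cast; ring
      _ = (((t + 1) * (b j).choose (e j) : ℕ) : MvPolynomial (Fin k) F) *
            (X j ^ (t + 1) * R) := by rw [hnat]
      _ = ((t + 1 : ℕ) : MvPolynomial (Fin k) F) *
            ((((b j).choose (e j) : ℕ) : MvPolynomial (Fin k) F) * X j ^ (t + 1) * R) := by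
          push_cast; ring
  · have h0 : (b j).choose (e j + 1) = 0 := Nat.choose_eq_zero_of_lt (by omega)
    have h1 : b j - e j = 0 := by omega
    rw [h0, h1]
    simp

/-- The recursion on the transfer weights: `∑_j (e_j+1) z_j · binom(b,e+δ_j) z^{b-e-δ_j}
= (∑_j (b_j - e_j)) · binom(b,e) z^{b-e}`. [folklore] -/
private theorem euler_shiftWt (e b : Fin k →₀ ℕ) :
    ∑ j : Fin k, ((e j + 1 : ℕ) : MvPolynomial (Fin k) F) * (X j *
      FSS2014.shiftWt (fun j : Fin k => (X j : MvPolynomial (Fin k) F))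
        (e + Finsupp.single j 1) b) =
    ((∑ j : Fin k, (b j - e j) : ℕ) : MvPolynomial (Fin k) F) *
      FSS2014.shiftWt (fun j : Fin k => (X j : MvPolynomial (Fin k) F)) e b := by
  simp_rw [euler_shiftWt_single]
  rw [← Finset.sum_mul, Nat.cast_sum]

/-- **Euler recursion** (Fact 10, "`∑ x_i ∂_{x_i} A = t · A`", in coefficient form): for `P`
homogeneous of degree `ℓ`, `∑_j (e_j + 1) · z_j · coeff_{y^{e+δ_j}} P(z+y) = (ℓ - |e|) · coeff_{y^e} P(z+y)`.
With `coeff_{y^e} P(z+y) = ∂_{z^e} P / e!` (characteristic `0`) this is Euler's formula for the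
homogeneous polynomial `∂_{z^e} P`; it lets the reconstruction recover ALL `coeff_{y^e} P_{n+j}`,
`|e| ≤ n`, from those with `|e| = n` ("compute all its lower order derivatives via repeated
applications of Euler's formula"). [cite: GuoKumarSaptharishiSolomon2019, Fact 10 and §3 (arXiv p0007.txt:L27-31, p0012.txt:L8)] -/
theorem euler_coeff_shiftR {P : MvPolynomial (Fin k) F} {ℓ : ℕ} (hP : P.IsHomogeneous ℓ)
    (e : Fin k →₀ ℕ) :
    ∑ j : Fin k, ((e j + 1 : ℕ) : MvPolynomial (Fin k) F) *
        (X j * coeff (e + Finsupp.single j 1) (shiftR P)) =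
      ((ℓ - e.degree : ℕ) : MvPolynomial (Fin k) F) * coeff e (shiftR P) := by
  classical
  simp_rw [coeff_shiftR, Finset.mul_sum]
  rw [Finset.sum_comm]
  refine Finset.sum_congr rfl fun b hb => ?_
  have hbdeg : b.degree = ℓ := by
    have := hP (mem_support_iff.mp hb)
    rwa [Finsupp.degree_eq_weight_one]
  have hstep : ∑ j : Fin k, ((e j + 1 : ℕ) : MvPolynomial (Fin k) F) * (X j * (C (coeff b P) *
      FSS2014.shiftWt (fun j : Fin k => (X j : MvPolynomial (Fin k) F))
        (e + Finsupp.single j 1) b)) =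
      C (coeff b P) * ∑ j : Fin k, ((e j + 1 : ℕ) : MvPolynomial (Fin k) F) * (X j *
        FSS2014.shiftWt (fun j : Fin k => (X j : MvPolynomial (Fin k) F))
          (e + Finsupp.single j 1) b) := by
    rw [Finset.mul_sum]
    exact Finset.sum_congr rfl fun j _ => by ring
  rw [hstep, euler_shiftWt]
  by_cases hle : e ≤ b
  · rw [sum_tsub_eq_degree_sub hle, hbdeg]
    ring
  · rw [shiftWt_eq_zero_of_not_le hle]
    simp

/-! ### `Δ_i(P)(z, a)` as a linear combination of the `y`-coefficients -/

/-- `Δ_i(P)(z, a) = ∑_{|e| = i} a^e · coeff_{y^e} P(z+y)` ("`Δ_n(P_{n+j})(z, a)` is a suitable linear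
combination of the `n`-th order partial derivatives of `P_{n+j}(z)`").
[cite: GuoKumarSaptharishiSolomon2019, §3 (arXiv p0012.txt:L5-7)] -/
theorem eval_homogeneousComponent_shiftR (P : MvPolynomial (Fin k) F) (g : Fin k → F) (i : ℕ) :
    eval (fun j => C (g j)) (homogeneousComponent i (shiftR P)) =
      ∑ e ∈ (shiftR P).support with e.degree = i,
        C (∏ j, g j ^ e j) * coeff e (shiftR P) := by
  classical
  rw [homogeneousComponent_apply, map_sum]
  refine Finset.sum_congr rfl fun e _ => ?_
  rw [eval_monomial, Finsupp.prod_fintype _ _ (fun _ => pow_zero _), mul_comm]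
  congr 1
  rw [map_prod]
  exact Finset.prod_congr rfl fun j _ => (map_pow C (g j) (e j)).symm

end GKSS2019


end Literature.Computability.AlgebraicComplexity
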